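import Summits.BirchSwinnertonDyer.BirchSwinnertonDyer.Theorems.EdixhovenFibreFiveSevenStarredOptimalManinUnitFiveSevenTransportedReciprocityTransportAllPoints
import Literature.NumberTheory.EllipticCurves.VariableChangeTransportData
import HarnessLib

/-!
# Kato's explicit reciprocity law for a curve related to a RAMIFIED good supersingular model by ONE change of variables over `K_v` —
# the `hrec′` shape from `(C, C • (W ⊗ F) = E, |u| ≤ 1)` alone

Cell `pub/bsd-wall`, D-0145 line `route-BirchSwinnertonDyer-EdixhovenFibreFiveSeven`, seat `bsd-line-edix-p4` (gen 28); crux K★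
`stmt-BirchSwinnertonDyer-22226` (`StarredOptimalManinUnitFiveSeven`), line `kato_lever`, memo `Cruxes/StarredOptimalManinUnitFiveSeven/Lines/
kato-lever-K2-transport-allpoints.md` §2. THEOREMS ONLY (no definition, no named fact, no instance, no `sorry`); helper `--supports stmt-BirchSwinnertonDyer-22226`.
**BSD is not proved by this file, and neither is K★ or [REC-tower].** It composes `…TransportedReciprocityTransportAllPoints.exists_const_tatePairingPoint_eq_trace_mul_padicLog_transport_of_log_eq`
(E5) with the transport data of a change of variables (`Literature…VariableChangeTransportData`: `exists_transportData_of_variableChange`,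
`padicLogPointFiniteExt_congrEquiv_pointMap_of_isNonarchimedeanLocalField`): the isomorphism `φ`, its Tate-module map, the rational substitution `φ_F` and
the rescaling `log_ω^E(ι_C P) = u·log_ω^{W⊗F}(P)` are no longer inputs — the caller supplies ONE admissible change of variables `C` over `F = K_v` with
`C • (W ⊗ F) = E` and `|u| ≤ 1`, besides the model data and the socket cell data for `W`.

* ★★★★ `exists_const_tatePairingPoint_eq_trace_mul_padicLog_of_variableChange` — **`∃ c, ∀ η ∈ Z¹(Γ_F, T_pW), ∀ P ∈ W(F):
  ⟨[η], P⟩_W = Tr_{F/ℚ_p}(c · exp*_d(η) · log_ω^{W ⊗ F}(P))`** = the hypothesis `hrec′` of `…ReciprocityTowerFromAbove.exists_const_tower_clauses_of_formula_above`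
  at `K′ := F`.

References: [cite: Kato1993LNM1553, Ch. II Thm. 1.4.1 (3)–(4), Lemma 1.4.3] · [cite: BlochKato1990, Ex. 3.10.1, Example 3.11] ·
[cite: SilvermanAEC2009, III.1 Table 3.1, Prop. III.3.1(b), Thm. IV.6.4, Prop. VII.2.2, X §4].
-/

set_option autoImplicit false
-- single-conjunct summit: `Summit.BirchSwinnertonDyer.BirchSwinnertonDyer.…` repeats the name by design
set_option linter.dupNamespace false

noncomputable section

open Field Function ValuativeRel WittVector NumberField IsDedekindDomain
open scoped NumberField Topology Classical NNReal
open Literature.NumberTheory.PAdicHodge Literature.NumberTheory.GaloisRepresentations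
  Literature.NumberTheory.GaloisRepresentations.IsNonarchimedeanLocalField Literature.NumberTheory.GaloisRepresentations.LubinTate
  Literature.NumberTheory.GaloisCohomology Literature.NumberTheory.EllipticCurves Literature.NumberTheory.EllipticCurves.FormalGroupChart
  Literature.NumberTheory.PAdicHodge.GaloisContinuity Literature.IUT.LogVolume Literature.RingTheory.FormalGroups
  Literature.AlgebraicGeometry.Resolution _root_.WeierstrassCurve _root_.WeierstrassCurve.VariableChange

namespace Summit.BirchSwinnertonDyer.BirchSwinnertonDyer.Theorems.TransportedReciprocityOfVariableChange

variable {K : Type} [Field K] [NumberField K] {p : ℕ} [hprime : Fact p.Prime] (v : HeightOneSpectrum (𝓞 K))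
  [CharZero (v.adicCompletion K)] [LocallyCompactSpace (absoluteGaloisGroup (v.adicCompletion K))]
  [Fact (¬ IsUnit (p : integerC (v.adicCompletion K)))]
  [IsAdicComplete (Ideal.span {(p : integerC (v.adicCompletion K))}) (integerC (v.adicCompletion K))]
  [CharP 𝓀[v.adicCompletion K] p] [CharZero (CompletedAlgClosure (v.adicCompletion K))]
  (hpv : valuation (v.adicCompletion K) (p : v.adicCompletion K) < 1)
  (Dv : EisensteinRoot (v.adicCompletion K) p hpv) (Wm : WeierstrassCurve (EisensteinRoot.CoeffDisc Dv))
  (ψm : EisensteinRoot.CoeffDisc Dv →+* LTCoeff (v.adicCompletion K))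
  (hψm : ∀ c, algebraMap (LTCoeff (v.adicCompletion K)) (v.adicCompletion K) (ψm c) = EisensteinRoot.CoeffDisc.toF Dv c)
  (hp2 : p ≠ 2) (hΔ : IsUnit (Wm.map ψm).Δ) (hA : ((Wm.map ψm).map (AinfTop.redCoeff (v.adicCompletion K))).hasseCoeff p = 0)
  [(AinfTop.curveFO (v.adicCompletion K) (Wm.map ψm)).IsElliptic]
  [(curveOver (CompletedAlgClosure (v.adicCompletion K)) (Wm.map ψm)).IsElliptic]
  -- the curve `W/K₀` and its Weil tower
  {K₀ : Type} [Field K₀] [CharZero K₀] (W : WeierstrassCurve K₀) [W.IsElliptic] [Algebra K₀ (v.adicCompletion K)]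
  (e : (k : ℕ) → geomTorsion W ((p ^ k : ℕ) : ℤ) → geomTorsion W ((p ^ k : ℕ) : ℤ) → AlgebraicClosure K₀)
  (hμ : ∀ k S T, e k S T ^ (p ^ k) = 1) (hadd₁ : ∀ k S₁ S₂ T, e k (S₁ + S₂) T = e k S₁ T * e k S₂ T)
  (hadd₂ : ∀ k S T₁ T₂, e k S (T₁ + T₂) = e k S T₁ * e k S T₂)
  (hgal : ∀ k (σ : absoluteGaloisGroup K₀) (S T : geomTorsion W ((p ^ k : ℕ) : ℤ)), σ • e k S T = e k (σ • S) (σ • T))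
  (hcompat : ∀ k (S T : geomTorsion W ((p ^ (k + 1) : ℕ) : ℤ)),
    e k (torsionMulHom W (p ^ (k + 1)) (p ^ k) p (pow_succ p k).symm S)
      (torsionMulHom W (p ^ (k + 1)) (p ^ k) p (pow_succ p k).symm T) = e (k + 1) S T ^ p)

set_option maxHeartbeats 1600000 in
include hgal hp2 hΔ hA hψm in
/-- ★★★★ **Kato's explicit reciprocity law in the shape `hrec′`, from ONE change of variables onto a ramified good supersingular model.** `F = K_v`;
`E = curveFO F (W_D ⊗_ψ 𝒪_F)` good supersingular, `W_D ≡ E₀ (mod ϖ)`, `E₀/ℤ` good supersingular at `p ≥ 5`, `N ≥ e`, (N1′); `W/K₀` (`K₀ ⊆ F`) elliptic with the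
socket cell data over `F` (Weil tower, `ψ = log χ`, `hinj/hde/d` for `T_pW|_{Γ_F}`); an admissible change of variables `C = (u, r, s, t)` over `F` with
`C • (W ⊗ F) = E` and `|u|_w ≤ 1` for a compatible valuation `w` making `W ⊗ F` integral. Then ONE `c ∈ F` gives, for every cocycle `η` of `T_pW|_{Γ_F}` and
EVERY `P ∈ W(F)`: **`⟨[η], P⟩_W = Tr_{F/ℚ_p}(c · exp*_d(η) · log_ω(P))`**, `log_ω = padicLogPointFiniteExt w (W ⊗ F) p`.
[cite: Kato1993LNM1553, Ch. II Thm. 1.4.1 (3)–(4), Lemma 1.4.3] [cite: SilvermanAEC2009, III.1 Table 3.1, Prop. III.3.1(b), X §4] -/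
theorem exists_const_tatePairingPoint_eq_trace_mul_padicLog_of_variableChange (hp5 : 5 ≤ p)
    (E₀ : WeierstrassCurve ℤ)
    (hWE : Wm.map (Ideal.Quotient.mk (Ideal.span {EisensteinRoot.CoeffDisc.of Dv (AdjoinRoot.root Dv.poly)})) =
      (E₀.map (algebraMap ℤ (EisensteinRoot.CoeffDisc Dv))).map
        (Ideal.Quotient.mk (Ideal.span {EisensteinRoot.CoeffDisc.of Dv (AdjoinRoot.root Dv.poly)})))
    (hΔ₀ : ¬ (p : ℤ) ∣ E₀.Δ) (hA₀ : (E₀.map (Int.castRingHom (ZMod p))).hasseCoeff p = 0)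
    [(E₀.map (Int.castRingHom ℚ_[p])).IsElliptic] [(E₀.map (Int.castRingHom (ZMod p))).IsElliptic]
    [(curveOver (CompletedAlgClosure (v.adicCompletion K)) E₀).IsElliptic]
    {N : ℕ} (hN : Dv.e ≤ N)
    (hN1' : ∃ τ : AinfTop.TatePtO (v.adicCompletion K) (Wm.map ψm) p,
      AinfRamTop.omegaPeriod Wm (surjective_fontaineTheta_integerC hpv) (AinfTop.seqO (Wm.map ψm) τ) (AinfTop.seqO_zero (Wm.map ψm) τ)
        (AinfRamTop.mulPC_seqO Wm ψm hψm τ) ≠ 0)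
    (ψ : C(absoluteGaloisGroup (v.adicCompletion K), ℤ_[p])) (hψ : ∀ σ τ, ψ (σ * τ) = ψ σ + ψ τ)
    (hψlog : ∀ τ, (ψ τ : ℚ_[p]) = logCyclotomic (F := (v.adicCompletion K)) p τ)
    (heL : ∀ (c : ℤ_[p]) (S U : W.tateModule p),
      (weilContPairingPadic W (v.adicCompletion K) p e hμ hadd₁ hadd₂ hgal hcompat).toLin (c • S) U =
      twistHom (v.adicCompletion K) p ((weilContPairingPadic W (v.adicCompletion K) p e hμ hadd₁ hadd₂ hgal hcompat).toLin S U) c)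
    (healt : ∀ S : W.tateModule p,
      (weilContPairingPadic W (v.adicCompletion K) p e hμ hadd₁ hadd₂ hgal hcompat).toLin S S = 0)
    (henondeg : ∀ S : W.tateModule p,
      (∀ U, (weilContPairingPadic W (v.adicCompletion K) p e hμ hadd₁ hadd₂ hgal hcompat).toLin S U = 0) → S = 0)
    (hinj : letI := LocalField.padicAlgebra (v.adicCompletion K) p hpv
      (bdRPeriodRingData (F := (v.adicCompletion K)) (p := p) hpv).CupLogInjective (logCyclotomic p)
        (restrictedRationalTateRep W (v.adicCompletion K) p))
    (hde : letI := LocalField.padicAlgebra (v.adicCompletion K) p hpv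
      ∀ η : contOneCocycles (restrictedTateRep W (v.adicCompletion K) p).toTopRep,
        (bdRPeriodRingData (F := (v.adicCompletion K)) (p := p) hpv).HasDualExp (logCyclotomic p)
          (restrictedRationalTateRep W (v.adicCompletion K) p)
          fun σ => TateModule.toRational p (η.1 σ))
    (d : letI := LocalField.padicAlgebra (v.adicCompletion K) p hpv
      (bdRPeriodRingData (F := (v.adicCompletion K)) (p := p) hpv).FilZeroLine
        (restrictedRationalTateRep W (v.adicCompletion K) p))
    -- the change of variables onto the model and the valuation for `log_ω`
    (w : Valuation (v.adicCompletion K) ℝ≥0) [w.Compatible] [(AinfTop.curveFO (v.adicCompletion K) (Wm.map ψm)).IsIntegral w.integer]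
    [(W.baseChange (v.adicCompletion K)).IsIntegral w.integer]
    (C : VariableChange (v.adicCompletion K)) (hC : C • W.baseChange (v.adicCompletion K) = AinfTop.curveFO (v.adicCompletion K) (Wm.map ψm))
    (hu : w (C.u : v.adicCompletion K) ≤ 1) :
    letI := LocalField.padicAlgebra (v.adicCompletion K) p hpv
    ∃ c : v.adicCompletion K,
      ∀ (η : contOneCocycles (restrictedTateRep W (v.adicCompletion K) p).toTopRep) (P : (W.baseChange (v.adicCompletion K)).toAffine.Point),
        ((tatePairingPoint W (v.adicCompletion K) p e hμ hadd₁ hadd₂ hgal hcompat (oneCocycleClass _ η) P : ℤ_[p]) : ℚ_[p]) =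
          Algebra.trace ℚ_[p] (v.adicCompletion K)
            (c * expStarCoord W hpv d η * padicLogPointFiniteExt w (W.baseChange (v.adicCompletion K)) p P) := by
  letI := LocalField.padicAlgebra (v.adicCompletion K) p hpv
  haveI : (W.baseChange (v.adicCompletion K)).IsElliptic := inferInstance
  -- the transport data of `C`
  obtain ⟨φ, Tφ, φF, hφ, hTφ, hφF, hφFC⟩ := exists_transportData_of_variableChange (W.baseChange (v.adicCompletion K)) C p hC
  -- the rescaling of `log_ω`
  have hlogφ : ∀ P, padicLogPointFiniteExt w (AinfTop.curveFO (v.adicCompletion K) (Wm.map ψm)) p (φF P) =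
      (C.u : v.adicCompletion K) * padicLogPointFiniteExt w (W.baseChange (v.adicCompletion K)) p P := fun P => by
    rw [hφFC P]
    exact padicLogPointFiniteExt_congrEquiv_pointMap_of_isNonarchimedeanLocalField (W.baseChange (v.adicCompletion K)) C w hC hpv hu P
  -- E5 (STEPWISE application)
  have h1 := TransportedReciprocityTransportAllPoints.exists_const_tatePairingPoint_eq_trace_mul_padicLog_transport_of_log_eq v hpv Dv Wm ψm hψm hp2 hΔ
    hA W φ hφ Tφ hTφ e hμ hadd₁ hadd₂ hgal hcompat hp5 E₀ hWE hΔ₀ hA₀ (N := N) hN hN1' ψ hψ hψlog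
  have h2 := h1 heL healt henondeg
  have h3 := h2 hinj hde d w φF hφF w (C.u : v.adicCompletion K) hlogφ
  exact h3

end Summit.BirchSwinnertonDyer.BirchSwinnertonDyer.Theorems.TransportedReciprocityOfVariableChange

end
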